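import Mathlib
import Literature.Analysis.SpecialFunctions.FactorialRootLimit

/-!
# `DivisionGap.PerMultiplesHard` (stmt-ValiantsHypothesis-5068), line `uncharged-face-walk`:
stub `stub_stirlingGamma` — the one-sided Stirling bound `log D! ≤ D log D − D + ½ log D + 1`

The line bounds fibres of perfect-matching sets by Brégman–Minc, `∏_j (d_j !)^{1/d_j}`, and needs
the sharp size of the Brégman exponent `γ(D) = log (D !) / D ≈ log D − 1`; the crude `D ! ≤ D^D`
loses a factor `e` per column.  This stub is the upper Stirling bound

  `D ! ≤ e · √D · (D/e)^D`, i.e. `log D ! ≤ D log D − D + (log D)/2 + 1`  (`D ≥ 1`).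

Proof.  This is the tree's `Literature.Analysis.SpecialFunctions.log_factorial_le` (for `D ≠ 0`),
which comes from Mathlib's Stirling file: `Stirling.stirlingSeq D ≤ Stirling.stirlingSeq 1 = e/√2`
for `D ≥ 1` (`Stirling.stirlingSeq'_antitone`, `Stirling.stirlingSeq_one`) and
`D ! = stirlingSeq D · √(2D) · (D/e)^D` (`Stirling.log_stirlingSeq_formula`), then take logarithms.
The matching lower bound (not needed here) is Mathlib's `Stirling.le_log_factorial_stirling`.
At `D = 1` the bound is an equality (`0 ≤ 0 − 1 + 0 + 1`).
-/

noncomputable section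

-- `Summit.ValiantsHypothesis.ValiantsHypothesis.…` is the tree's mandated layout (Sub = Summit).
set_option linter.dupNamespace false

namespace Summit.ValiantsHypothesis.ValiantsHypothesis.Theorems.DivisionGap.PerMultiplesHard.StirlingGamma

/-- **stub_stirlingGamma — upper Stirling bound in logarithmic form.**  For every `D ≥ 1`,
`log (D !) ≤ D log D − D + (log D)/2 + 1`, i.e. `D ! ≤ e √D (D/e)^D`: the Stirling sequence
`D ! / (√(2D) (D/e)^D)` is antitone from `1` on, where it equals `e/√2`
(`Literature.Analysis.SpecialFunctions.log_factorial_le`, from Mathlib's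
`Stirling.stirlingSeq'_antitone`, `Stirling.stirlingSeq_one`, `Stirling.log_stirlingSeq_formula`).
[folklore] -/
theorem stub_stirlingGamma :
    ∀ (D : ℕ), 1 ≤ D →
      Real.log ((D.factorial : ℕ) : ℝ) ≤
        (D : ℝ) * Real.log (D : ℝ) - (D : ℝ) + Real.log (D : ℝ) / 2 + 1 :=
  fun _ hD => Literature.Analysis.SpecialFunctions.log_factorial_le (Nat.one_le_iff_ne_zero.mp hD)

end Summit.ValiantsHypothesis.ValiantsHypothesis.Theorems.DivisionGap.PerMultiplesHard.StirlingGamma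

end
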